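import Summits.CriticalPhenomena.PercolationContinuityZ3.Theorems.PercNearOneGluingNoHeavyLowerTailMajorityGluingHubRefreshIsoFiveMain
import Summits.CriticalPhenomena.PercolationContinuityZ3.Theorems.PercNearOneGluingNoHeavyLowerTailMajorityGluingHubRefreshAggStar
import HarnessLib

/-!
# The weak `(4,3)` cell of C(6) = 2 from (AGG★_{1/2}) ALONE (lane prim-rate, constants-miner 1, gen 17; CANDIDATES §GEN-17 R134)

Support file for the closed crux `NoHeavyLowerTail` (stmt-CriticalPhenomena-4575), majority-gluing line: the conditional reduction
`weakCell_of_aggAt_of_iso5` (file …HubRefreshAggStar) with (ISO5) discharged by THEOREM E (`IsoFive.iso5`, file …HubRefreshIsoFiveMain).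
* `IsoFive.weakCell_of_aggAt` — **`(1 − M)·μ(≥ 3 of 4 relays cut) ≤ M` from (AGG★_{1/2})**:
  `μ(≥ 3 cut) − M ≤ μ(v_i ↔ a ∧ others cut ∧ off-hub blocks pairwise distinct ∧ q(block of v_i) ≥ 1/2)`;
* `IsoFive.weakCell_of_agg_half` — the old hypothesis shape (AGG′_θ with `dangerSet` = all four blocks light) suffices for every `θ ≥ 1/2`
  (compare `IsoFive.weakCell_of_agg`: `θ ≥ 5/6`).
No definitions, no named facts, no sorries.  (Written gen 17; landed gen 24 once the `…HubRefreshAggStar` olean existed — the applications go through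
`convert`, because the `DecidablePred` instance of the `Finset.filter` in the statements differs between the two imported files.)
[cite: VandenbergHaggstromKahn2005, Thm. 1.3 (p. 6)]
-/

noncomputable section

namespace Summit.CriticalPhenomena.PercolationContinuityZ3.Theorems

open MeasureTheory Set
open Literature.Probability.LatticeModels (prodBernoulli)
open Literature.Probability.Percolation
open scoped Classical

namespace HubOnly
namespace Refresh

variable {n : ℕ}

namespace IsoFive

/-- **THE WEAK (4,3) CELL OF C(6) = 2 FROM (AGG★_{1/2}) ALONE.**  For a hub `a`, four relays `R ∌ a`, `i ∈ R` and a cut bound `M`: IF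
(AGG★) `μ(≥ 3 of the 4 relays cut) − M ≤ μ(v_i ↔ a ∧ the other three cut ∧ the off-hub blocks of the relays pairwise distinct ∧ q(block of v_i) ≥ 1/2)`
THEN `(1 − M)·μ(≥ 3 of the 4 relays cut) ≤ M` — `weakCell_of_aggAt_of_iso5` at `θ = 1/2` with (ISO5) discharged by THEOREM E (`iso5`).
The danger event here contains the one of `weakCell_of_agg` (all four blocks light at level `5/6`), so (AGG★) is the weaker hypothesis;
it is the last inline hypothesis of the lane's C(6) = 2 chain (CANDIDATES §GEN-17). [cite: VandenbergHaggstromKahn2005, Thm. 1.3 (p. 6)] -/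
theorem weakCell_of_aggAt (w : Sym2 (Fin n) → unitInterval) (a : Fin n) (R : Finset (Fin n)) (haR : a ∉ R)
    (hR : R.card = 4) {i : Fin n} (hi : i ∈ R) {M : ℝ}
    (hM : ∀ v ∈ R, (prodBernoulli w).real {ω : BondConfig (Fin n) | ¬ (openGraph ω).Reachable a v} ≤ M)
    (hAGG : (prodBernoulli w).real {ω : BondConfig (Fin n) | 3 ≤ (R.filter fun v => ¬ (openGraph ω).Reachable a v).card} - M ≤
      (prodBernoulli w).real {ω : BondConfig (Fin n) | (openGraph ω).Reachable a i ∧ (∀ j ∈ R, j ≠ i → ¬ (openGraph ω).Reachable a j) ∧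
        ((∀ v ∈ R, ∀ v' ∈ R, v ≠ v' → clus (offCfg {a} ω) v ≠ clus (offCfg {a} ω) v') ∧
          (1 / 2 : ℝ) ≤ 1 - attachProb w {a} (clus (offCfg {a} ω) i))}) :
    (1 - M) * (prodBernoulli w).real {ω : BondConfig (Fin n) | 3 ≤ (R.filter fun v => ¬ (openGraph ω).Reachable a v).card} ≤ M := by
  have h := weakCell_of_aggAt_of_iso5 (θ := 1 / 2) w a R (fun v hv hva => haR (hva ▸ hv)) hi (le_refl _)
    (by norm_num) hM (by convert hAGG using 9) (iso5 w a R haR hR)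
  convert h using 9

/-- **The old hypothesis shape suffices for every `θ ≥ 1/2`.**  (AGG′_θ) with the `dangerSet` of `…HubRefreshWindow` (all four blocks light at level
`θ`, blocks pairwise distinct) and `1/2 ≤ θ ≤ 1` give the weak cell — because `dangerSet ⊆ D★` (the block of `v_i` is one of the four).  Compare
`weakCell_of_agg` (`θ ≥ 5/6`). [cite: VandenbergHaggstromKahn2005, Thm. 1.3 (p. 6)] -/
theorem weakCell_of_agg_half (w : Sym2 (Fin n) → unitInterval) (a : Fin n) (R : Finset (Fin n)) (haR : a ∉ R)
    (hR : R.card = 4) {i : Fin n} (hi : i ∈ R) {M θ : ℝ} (hθ : 1 / 2 ≤ θ) (hθ1 : θ ≤ 1)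
    (hM : ∀ v ∈ R, (prodBernoulli w).real {ω : BondConfig (Fin n) | ¬ (openGraph ω).Reachable a v} ≤ M)
    (hAGG : (prodBernoulli w).real {ω : BondConfig (Fin n) | 3 ≤ (R.filter fun v => ¬ (openGraph ω).Reachable a v).card} - M ≤
      (prodBernoulli w).real {ω : BondConfig (Fin n) | (openGraph ω).Reachable a i ∧ (∀ j ∈ R, j ≠ i → ¬ (openGraph ω).Reachable a j) ∧
        offCfg {a} ω ∈ dangerSet w a R θ}) :
    (1 - M) * (prodBernoulli w).real {ω : BondConfig (Fin n) | 3 ≤ (R.filter fun v => ¬ (openGraph ω).Reachable a v).card} ≤ M := by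
  have hsub : {ω : BondConfig (Fin n) | (openGraph ω).Reachable a i ∧ (∀ j ∈ R, j ≠ i → ¬ (openGraph ω).Reachable a j) ∧
        offCfg {a} ω ∈ dangerSet w a R θ} ⊆
      {ω : BondConfig (Fin n) | (openGraph ω).Reachable a i ∧ (∀ j ∈ R, j ≠ i → ¬ (openGraph ω).Reachable a j) ∧
        ((∀ v ∈ R, ∀ v' ∈ R, v ≠ v' → clus (offCfg {a} ω) v ≠ clus (offCfg {a} ω) v') ∧
          θ ≤ 1 - attachProb w {a} (clus (offCfg {a} ω) i))} := by
    rintro ω ⟨hri, hcut, hdz⟩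
    exact ⟨hri, hcut, (mem_dangerSet.1 hdz).1, (mem_dangerSet.1 hdz).2 i hi⟩
  have hAGG' := hAGG.trans (measureReal_mono (h₂ := measure_ne_top _ _) hsub)
  have h := weakCell_of_aggAt_of_iso5 w a R (fun v hv hva => haR (hva ▸ hv)) hi hθ hθ1 hM (by convert hAGG' using 9; rfl) (iso5 w a R haR hR)
  convert h using 9

end IsoFive

end Refresh
end HubOnly
end Summit.CriticalPhenomena.PercolationContinuityZ3.Theorems
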